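/-
Copyright: statement-level skeleton of a published paper (lit-balaban cell, Phase-2 proof seat p32 gen 43). No claims beyond
what the kernel checks below.
-/
import Literature.MathematicalPhysics.QuantumFieldTheory.Balaban1983to89.B3OnePIChainGlueCount

/-!
# B3 — T. Bałaban, *(Higgs)₂,₃ quantum fields in a finite volume. III. Renormalization*, CMP **88** (1983) 411–445
[Balaban1983Higgs3] — p. 416 [PDF 6] (1.21): THE BLOCKS OF A CHAIN OF INSERTIONS — for p37's list-recursive chains
`B3OnePIChainGlue.chain T l` (the graph of the term `C₀^ε K₀ C₀^ε K₁ C₀^ε ⋯ K_r C₀^ε` of (1.21) whose `r + 1` letters are the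
graph insertions `T, l₀, …, l_{r-1}`) the vertices, legs and lines of the glued graph are identified BLOCK BY BLOCK with those
of the letters, and the chain decomposition of `B3OnePIChainDecomposition` (pieces `V_k = {level = k}`, separating lines) is
computed on it: for PROPER letters the `k`-th piece IS the vertex block of the `k`-th letter and the separating lines ARE the
`r` glue lines — «decompose ∘ glue = identity» at the level of vertices and lines

statement-level skeleton of published theorems with citation tags; proofs where landed; nothing here is a claim about
the Yang–Mills mass gap

PDF held: `paper:balaban1983-higgs-2-3-quantum-fields-finite-volume` (journal page = PDF page + 410); p. 416 L13–18 re-read this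
session on the OCR text layer.

CITATION HEADER (lean-in-tree rule).  lit-balaban TYPED SKELETON (HOME `run/shared/lean/pub/lit-balaban/`), PHASE 2, seat p32
gen 43 (unit `lit-balaban-p32`; TAKING line HOME/STATUS.md 2026-08-23T12:35:36Z, free-target protocol G.5-34(d)), row
**B3.Eq1.19-1.22** of `HOME/lit-balaban-r15/ROWS-B3.md` (fold owner r15, referee ref-4; head `proved` under the lead g12 HEAD WORD
Q25, reading (P); this file is an OPTIONAL located member of its (1.21) cell, zero head weight — the successor item (d)(ii)/(i)
named in p32 gen 42's HANDOFF).  CONSUMES BY NAME: p37 g106's `B3OnePIChainGlue.TwoLegGraph` / `glue2` / `chain` (p363250),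
`B3GraphGlue.glue` with `adj_glue_left` / `adj_glue_right` / `adj_glue_cases` (p362777), `B3GraphGlueLegs.legL` / `legR` /
`glueOther_legL_of_ne` / `glueOther_legR_of_ne` / `glueOther_legL_self` (p362350), `B3OnePIGraphs.IsConnected` / `IsProper` /
`Adj` (p358806); p32's `B3OnePIChainDecomposition.level` / `numSep` / `nearLegs` / `IsNear` (p361829),
`B3OnePIChainPieces.isProper_iff_numSep_eq_zero` (p362812), `B3OnePIChainGlueLevels.level_glue_left` / `level_glue_right` /
`mem_nearLegs_glue` (p363678).  Nothing re-declared; p18's model `B3Cor23Concrete.Graph` untouched.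

THE PRINTED TEXT (verbatim).  p. 416: *"G^ε = Σ_{n=0}^∞ C₀^ε[(−δm² + Σ^ε + ∂^{ε*}Σ₁^ε + Σ₁^{ε*}∂^ε + ∂^{ε*}Σ₂^ε∂^ε)C₀^ε]ⁿ, (1.21)
where C₀^ε = (−Δ₀^ε + m²)^{−1} and Σ^ε, Σ₁^ε, Σ₂^ε are given by amputated, one-particle-irreducible graphs of the expansion of G^ε."*
p. 415: *"Now a graph for us is a collection of internal lines, external legs, and vertices connected in the usual sense. There
is at least one internal line, and every internal line has a vertex at each endpoint. The construction of graphs is otherwise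
arbitrary."*

WHAT IS TYPED / PROVED (definitions with bodies + theorems; no `Prop` fact, no `sorry`; standard axioms).
* `§1` `letter T l k` — the `k`-th letter of the chain (`T`, then the entries of `l`; `letter_eq_getElem`); `letter_pred`.
* `§2` `blockOf : Fin (chain T l).G.nV → ℕ` — the block index of a vertex (`blockOf_le`: `≤ l.length`); `blockEmb T l k :
  Fin (letter T l k).G.nV → Fin (chain T l).G.nV` — the block embeddings (iterated `Fin.castAdd` / `Fin.natAdd`):
  `blockOf_blockEmb` (`= min k l.length`), **`blockEmb_injective`**, **`exists_blockEmb_eq`** (jointly surjective),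
  `eq_of_blockEmb_eq` (blocks disjoint), **`kind_blockEmb`** (the catalogue vertex is kept), **`blockEquiv`**:
  `(Σ k : Fin (l.length+1), Fin (letter T l k).G.nV) ≃ Fin (chain T l).G.nV` — THE VERTICES OF THE CHAIN ARE THE DISJOINT UNION
  OF THE VERTICES OF ITS LETTERS (`chain_nV_eq_sum_letter` re-derives p37's `chain_nV`).
* `§3` `legEmb T l k : Leg (letter T l k).G.kind → Leg (chain T l).G.kind` (iterated `legL` / `legR`): `fst_legEmb`, `isLeft_legEmb`,
  `legEmb_injective`, `exists_legEmb_eq`; the ports `legEmb_zero_legIn` (= the chain's in-leg), `legEmb_length_legOut` (= its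
  out-leg); **`other_legEmb`** — away from the glued ports the line through an embedded leg is the embedded line of its letter
  (external legs stay external); **`other_legEmb_legOut`** / `other_legEmb_succ_legIn` — THE GLUE LINES join the out-leg of
  letter `k` to the in-leg of letter `k + 1`; `other_legEmb_zero_legIn` / `other_legEmb_length_legOut`;
  **`other_legEmb_eq_none_iff`** — the external legs of the chain.
* `§4` `adj_blockEmb` (lines of a letter are lines of the chain), `adj_blockEmb_ports` (consecutive letters are adjacent through
  their glue line), **`adj_chain_cases`** (there is no other line).
* `§5` **`mem_nearLegs_chain_iff`** (connected letters): the separating lines of the chain between its in-leg and out-leg are the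
  `l.length` glue lines (near leg = the out-port of the earlier letter, `isNear_chain_legEmb_legOut`) and the embedded
  separating lines of the letters; **`mem_nearLegs_chain_iff_of_proper`**: FOR PROPER LETTERS THEY ARE EXACTLY THE GLUE LINES.
* `§6` **`level_chain_blockEmb`** (connected letters, `k ≤ l.length`): `level (blockEmb k v) = Σ_{j<k} numSep (letter j) + k +
  level_{letter k} v`; **`level_chain_blockEmb_of_proper`**: `= k`; **`level_chain_eq_blockOf`**: for proper letters the level
  function of the chain IS the block index; **`piece_eq_map_blockEmb`**: the piece `V_k = {level = k}` of the chain
  decomposition is exactly the image of the `k`-th block embedding, `card_piece`: `#V_k = (letter k).G.nV`; `blockOf_ports`.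
* `§7` the displayed `n = 2` term ①—C₀^ε—① (`chain (pic1 n̄) [pic1 n̄]`): its two vertices sit at levels `0` and `1`.
Together with gen 42's `numSep_chain_of_proper` (`= l.length`) and `B3OnePIChainPieces.chain_decomposition`: decomposing the
chain of `r + 1` proper insertions returns `r + 1` pieces, the `k`-th being the `k`-th insertion's vertex set, separated by
exactly the `r` glue lines — the analysis of p32 gen 42 inverts the synthesis of p37 g106 on vertices, legs and lines.

HONEST SCOPE.  Combinatorial, on p18's model; the pieces are identified as vertex SETS with their legs and lines (an
isomorphism of `Graph n̄` sub-OBJECTS «piece `k` ≅ letter `k` with its two ports cut» is not packaged as a structure — every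
component of it is a theorem here: vertices `blockEquiv`/`piece_eq_map_blockEmb`, kinds `kind_blockEmb`, lines `other_legEmb`,
ports `other_legEmb_legOut`); the converse direction «a connected two-leg graph with proper pieces is `chain` of its pieces up
to isomorphism» is not constructed; no amplitude is attached (BRICK 2's `sigmaSeries_eq_greenSeries_of_equiv` stays
uninstantiated); nothing analytic.  For `k > l.length` the functions `letter` / `blockEmb` / `legEmb` return the last letter's
data (harmless total extensions; the theorems carry `k ≤ l.length` where it matters).
-/

namespace Literature.MathematicalPhysics.QuantumFieldTheory.Balaban1983to89.B3OnePIChainBlocks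

open Relation Finset B3Prop1 B3Cor23Concrete B3OnePIGraphs B3OnePIChainDecomposition B3OnePIChainPieces B3GraphGlueLegs
  B3GraphGlue B3OnePIChainGlueLevels B3OnePIChainGlue B3OnePIChainGlueCount

variable {nbar : ℕ}

/-! ## §1 The letters of a chain -/

/-- The `k`-th LETTER of the chain `chain T l` (the `k`-th graph insertion of the term `C₀K₀C₀K₁C₀⋯K_rC₀`): `T` for `k = 0`,
the `(k-1)`-th entry of `l` for `1 ≤ k ≤ l.length` (and, harmlessly, the last letter again for larger `k`).
[cite: Balaban1983Higgs3, (1.21) p.416] -/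
def letter (T : TwoLegGraph nbar) (l : List (TwoLegGraph nbar)) (k : ℕ) : TwoLegGraph nbar :=
  match k, l with
  | 0, _ => T
  | _ + 1, [] => T
  | k + 1, T' :: l' => letter T' l' k
termination_by structural k

/-- kernel: the `0`-th letter is the head. [cite: Balaban1983Higgs3, (1.21) p.416] -/
@[simp] theorem letter_zero (T : TwoLegGraph nbar) (l : List (TwoLegGraph nbar)) : letter T l 0 = T := rfl

/-- kernel: a one-letter chain has only its head. [cite: Balaban1983Higgs3, (1.21) p.416] -/
@[simp] theorem letter_nil (T : TwoLegGraph nbar) (k : ℕ) : letter T [] k = T := by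
  cases k <;> rfl

/-- kernel: the later letters of `chain T (T' :: l)` are the letters of `chain T' l`. [cite: Balaban1983Higgs3, (1.21) p.416] -/
@[simp] theorem letter_cons_succ (T T' : TwoLegGraph nbar) (l : List (TwoLegGraph nbar)) (k : ℕ) :
    letter T (T' :: l) (k + 1) = letter T' l k := rfl

/-- kernel: the letters are the entries of the list `T :: l`. [cite: Balaban1983Higgs3, (1.21) p.416] -/
theorem letter_eq_getElem (T : TwoLegGraph nbar) (l : List (TwoLegGraph nbar)) (k : ℕ) (hk : k < (T :: l).length) :
    letter T l k = (T :: l)[k] := by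
  induction l generalizing T k with
  | nil =>
      have : k = 0 := by simp at hk; omega
      subst this; rfl
  | cons T' l ih =>
      cases k with
      | zero => rfl
      | succ k =>
          rw [letter_cons_succ, List.getElem_cons_succ]
          exact ih T' k (by simpa using hk)

/-- kernel: beyond the last index the letter is the last letter. [cite: Balaban1983Higgs3, (1.21) p.416] -/
theorem letter_of_length_le (T : TwoLegGraph nbar) (l : List (TwoLegGraph nbar)) {k : ℕ} (hk : l.length ≤ k) :
    letter T l k = letter T l l.length := by
  induction l generalizing T k with
  | nil => simp
  | cons T' l ih =>
      cases k with
      | zero => simp at hk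
      | succ k => simpa using ih T' (by simpa using hk)

/-- kernel: a property of the head and of every list entry holds for every letter. [cite: Balaban1983Higgs3, (1.21) p.416] -/
theorem letter_pred {P : TwoLegGraph nbar → Prop} {T : TwoLegGraph nbar} {l : List (TwoLegGraph nbar)} (hT : P T)
    (hl : ∀ T' ∈ l, P T') (k : ℕ) : P (letter T l k) := by
  induction l generalizing T k with
  | nil => simpa using hT
  | cons T' l ih =>
      cases k with
      | zero => exact hT
      | succ k => exact ih (hl T' (by simp)) (fun T'' h => hl T'' (by simp [h])) k

/-! ## §2 The blocks of vertices -/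

/-- The BLOCK INDEX of a vertex of `chain T l`: `0` on the vertices of the head `T`, `k + 1` on the vertices coming from the
`k`-th block of `chain T' l'` when `l = T' :: l'` (the vertices of a glued graph are those of the first piece, then those of
the second, `B3GraphGlue.glue`). [cite: Balaban1983Higgs3, (1.21) p.416] -/
def blockOf : (T : TwoLegGraph nbar) → (l : List (TwoLegGraph nbar)) → Fin (chain T l).G.nV → ℕ
  | _, [] => fun _ => 0
  | T, T' :: l => Fin.addCases (m := T.G.nV) (n := (chain T' l).G.nV) (fun _ => 0) (fun w => blockOf T' l w + 1)

/-- The BLOCK EMBEDDING of the vertices of the `k`-th letter into the vertices of the chain (iterated `Fin.castAdd` /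
`Fin.natAdd` along the consecutive glue). [cite: Balaban1983Higgs3, (1.21) p.416] -/
def blockEmb : (T : TwoLegGraph nbar) → (l : List (TwoLegGraph nbar)) → (k : ℕ) →
    Fin (letter T l k).G.nV → Fin (chain T l).G.nV
  | _, [], 0 => fun v => v
  | _, [], _ + 1 => fun v => v
  | _, T' :: l, 0 => fun v => Fin.castAdd (chain T' l).G.nV v
  | T, T' :: l, k + 1 => fun v => Fin.natAdd T.G.nV (blockEmb T' l k v)

/-- kernel: a one-letter chain is one block. [cite: Balaban1983Higgs3, (1.21) p.416] -/
@[simp] theorem blockOf_nil (T : TwoLegGraph nbar) (v : Fin (chain T []).G.nV) : blockOf T [] v = 0 := rfl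

/-- kernel: the head's vertices form block `0`. [cite: Balaban1983Higgs3, (1.21) p.416] -/
@[simp] theorem blockOf_cons_castAdd (T T' : TwoLegGraph nbar) (l : List (TwoLegGraph nbar)) (u : Fin T.G.nV) :
    blockOf T (T' :: l) (Fin.castAdd (chain T' l).G.nV u) = 0 := by
  simp [blockOf]

/-- kernel: the tail's blocks are shifted by one. [cite: Balaban1983Higgs3, (1.21) p.416] -/
@[simp] theorem blockOf_cons_natAdd (T T' : TwoLegGraph nbar) (l : List (TwoLegGraph nbar)) (w : Fin (chain T' l).G.nV) :
    blockOf T (T' :: l) (Fin.natAdd T.G.nV w) = blockOf T' l w + 1 := by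
  simp [blockOf]

/-- kernel: block indices run from `0` to `l.length`. [cite: Balaban1983Higgs3, (1.21) p.416] -/
theorem blockOf_le (T : TwoLegGraph nbar) (l : List (TwoLegGraph nbar)) (v : Fin (chain T l).G.nV) :
    blockOf T l v ≤ l.length := by
  induction l generalizing T with
  | nil => simp
  | cons T' l ih =>
      induction v using Fin.addCases with
      | left u => simp
      | right w => simpa using ih T' w

/-- kernel: in a one-letter chain the block embedding is the identity (index `0`). [cite: Balaban1983Higgs3, (1.21) p.416] -/
@[simp] theorem blockEmb_nil_zero (T : TwoLegGraph nbar) (v : Fin T.G.nV) : blockEmb T [] 0 v = v := rfl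

/-- kernel: in a one-letter chain the block embedding is the identity (any index). [cite: Balaban1983Higgs3, (1.21) p.416] -/
@[simp] theorem blockEmb_nil_succ (T : TwoLegGraph nbar) (k : ℕ) (v : Fin T.G.nV) : blockEmb T [] (k + 1) v = v := rfl

/-- kernel: block `0` of `chain T (T' :: l)` is the left summand. [cite: Balaban1983Higgs3, (1.21) p.416] -/
@[simp] theorem blockEmb_cons_zero (T T' : TwoLegGraph nbar) (l : List (TwoLegGraph nbar)) (v : Fin T.G.nV) :
    blockEmb T (T' :: l) 0 v = Fin.castAdd (chain T' l).G.nV v := rfl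

/-- kernel: block `k + 1` of `chain T (T' :: l)` is block `k` of the tail, in the right summand.
[cite: Balaban1983Higgs3, (1.21) p.416] -/
@[simp] theorem blockEmb_cons_succ (T T' : TwoLegGraph nbar) (l : List (TwoLegGraph nbar)) (k : ℕ)
    (v : Fin (letter T' l k).G.nV) : blockEmb T (T' :: l) (k + 1) v = Fin.natAdd T.G.nV (blockEmb T' l k v) := rfl

/-- **the block embedding lands in its block**: `blockOf (blockEmb k v) = min k l.length`.
[cite: Balaban1983Higgs3, (1.21) p.416] -/
theorem blockOf_blockEmb (T : TwoLegGraph nbar) (l : List (TwoLegGraph nbar)) (k : ℕ) (v : Fin (letter T l k).G.nV) :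
    blockOf T l (blockEmb T l k v) = min k l.length := by
  induction l generalizing T k with
  | nil => simp
  | cons T' l ih =>
      cases k with
      | zero => simp
      | succ k => simp [ih, Nat.succ_min_succ]

/-- kernel: for `k ≤ l.length`, `blockOf (blockEmb k v) = k`. [cite: Balaban1983Higgs3, (1.21) p.416] -/
theorem blockOf_blockEmb_of_le (T : TwoLegGraph nbar) (l : List (TwoLegGraph nbar)) {k : ℕ} (hk : k ≤ l.length)
    (v : Fin (letter T l k).G.nV) : blockOf T l (blockEmb T l k v) = k := by
  rw [blockOf_blockEmb, min_eq_left hk]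

/-- **each block embedding is injective**. [cite: Balaban1983Higgs3, (1.21) p.416] -/
theorem blockEmb_injective (T : TwoLegGraph nbar) (l : List (TwoLegGraph nbar)) (k : ℕ) :
    Function.Injective (blockEmb T l k) := by
  induction l generalizing T k with
  | nil => cases k <;> exact fun _ _ h => h
  | cons T' l ih =>
      cases k with
      | zero => exact Fin.castAdd_injective _ _
      | succ k => exact (Fin.natAdd_injective _ _).comp (ih T' k)

/-- **the blocks exhaust the chain**: every vertex of `chain T l` is `blockEmb k v` for some `k ≤ l.length` and some vertex
`v` of the `k`-th letter. [cite: Balaban1983Higgs3, (1.21) p.416] -/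
theorem exists_blockEmb_eq (T : TwoLegGraph nbar) (l : List (TwoLegGraph nbar)) (w : Fin (chain T l).G.nV) :
    ∃ k, k ≤ l.length ∧ ∃ v : Fin (letter T l k).G.nV, blockEmb T l k v = w := by
  induction l generalizing T with
  | nil => exact ⟨0, le_rfl, w, rfl⟩
  | cons T' l ih =>
      induction w using Fin.addCases with
      | left u => exact ⟨0, Nat.zero_le _, u, rfl⟩
      | right w =>
          obtain ⟨k, hk, v, hv⟩ := ih T' w
          exact ⟨k + 1, by simpa using hk, v, by simp [hv]⟩

/-- kernel: the vertex `blockEmb (blockOf w) v = w` form — every vertex lies in the image of the embedding of ITS block.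
[cite: Balaban1983Higgs3, (1.21) p.416] -/
theorem exists_blockEmb_blockOf_eq (T : TwoLegGraph nbar) (l : List (TwoLegGraph nbar)) (w : Fin (chain T l).G.nV) :
    ∃ v : Fin (letter T l (blockOf T l w)).G.nV, blockEmb T l (blockOf T l w) v = w := by
  obtain ⟨k, hk, v, rfl⟩ := exists_blockEmb_eq T l w
  rw [blockOf_blockEmb_of_le T l hk]
  exact ⟨v, rfl⟩

/-- kernel: distinct blocks are disjoint — equal images force equal block indices (both `≤ l.length`).
[cite: Balaban1983Higgs3, (1.21) p.416] -/
theorem eq_of_blockEmb_eq (T : TwoLegGraph nbar) (l : List (TwoLegGraph nbar)) {k k' : ℕ} (hk : k ≤ l.length)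
    (hk' : k' ≤ l.length) {v : Fin (letter T l k).G.nV} {v' : Fin (letter T l k').G.nV}
    (h : blockEmb T l k v = blockEmb T l k' v') : k = k' := by
  rw [← blockOf_blockEmb_of_le T l hk v, h, blockOf_blockEmb_of_le T l hk']

/-- **the vertex kinds are kept**: the vertex `blockEmb k v` of the chain is the catalogue vertex `v` of the `k`-th letter.
[cite: Balaban1983Higgs3, (1.21) p.416] -/
theorem kind_blockEmb (T : TwoLegGraph nbar) (l : List (TwoLegGraph nbar)) (k : ℕ) (v : Fin (letter T l k).G.nV) :
    (chain T l).G.kind (blockEmb T l k v) = (letter T l k).G.kind v := by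
  induction l generalizing T k with
  | nil => cases k <;> rfl
  | cons T' l ih =>
      cases k with
      | zero => exact Fin.append_left _ _ v
      | succ k => exact (Fin.append_right T.G.kind (chain T' l).G.kind (blockEmb T' l k v)).trans (ih T' k v)

/-- **THE VERTICES OF A CHAIN ARE THE DISJOINT UNION OF THE VERTICES OF ITS LETTERS**:
`(Σ k : Fin (l.length + 1), Fin (letter T l k).G.nV) ≃ Fin (chain T l).G.nV`, `⟨k, v⟩ ↦ blockEmb k v`.
[cite: Balaban1983Higgs3, (1.21) p.416] -/
noncomputable def blockEquiv (T : TwoLegGraph nbar) (l : List (TwoLegGraph nbar)) :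
    (Σ k : Fin (l.length + 1), Fin (letter T l k).G.nV) ≃ Fin (chain T l).G.nV :=
  Equiv.ofBijective (fun p => blockEmb T l p.1 p.2) (by
    constructor
    · rintro ⟨k, v⟩ ⟨k', v'⟩ h
      have hkk' : (k : ℕ) = k' :=
        eq_of_blockEmb_eq T l (Nat.le_of_lt_succ k.2) (Nat.le_of_lt_succ k'.2) h
      have hk : k = k' := Fin.ext hkk'
      subst hk
      have hv : v = v' := blockEmb_injective T l k h
      subst hv
      rfl
    · intro w
      obtain ⟨k, hk, v, hv⟩ := exists_blockEmb_eq T l w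
      exact ⟨⟨⟨k, Nat.lt_succ_of_le hk⟩, v⟩, hv⟩)

/-- kernel: `blockEquiv` is `blockEmb`. [cite: Balaban1983Higgs3, (1.21) p.416] -/
@[simp] theorem blockEquiv_apply (T : TwoLegGraph nbar) (l : List (TwoLegGraph nbar))
    (p : Σ k : Fin (l.length + 1), Fin (letter T l k).G.nV) : blockEquiv T l p = blockEmb T l p.1 p.2 := rfl

/-- kernel: counting — the vertices of the chain are those of its letters (p37's `chain_nV`, re-derived from the
blocks): `(chain T l).G.nV = Σ_{k ≤ l.length} (letter T l k).G.nV`. [cite: Balaban1983Higgs3, (1.21) p.416] -/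
theorem chain_nV_eq_sum_letter (T : TwoLegGraph nbar) (l : List (TwoLegGraph nbar)) :
    (chain T l).G.nV = ∑ k : Fin (l.length + 1), (letter T l k).G.nV := by
  simpa using (Fintype.card_congr (blockEquiv T l)).symm

/-! ## §3 The legs and the lines of a chain, block by block -/

/-- The LEG EMBEDDING of the legs of the `k`-th letter into the legs of the chain (p37's `legL` / `legR` iterated along the
consecutive glue; vertex `blockEmb k`, same leg slot). [cite: Balaban1983Higgs3, (1.21) p.416] -/
def legEmb : (T : TwoLegGraph nbar) → (l : List (TwoLegGraph nbar)) → (k : ℕ) →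
    Leg (letter T l k).G.kind → Leg (chain T l).G.kind
  | _, [], 0 => fun x => x
  | _, [], _ + 1 => fun x => x
  | T, T' :: l, 0 => fun x => legL T.G.kind (chain T' l).G.kind x
  | T, T' :: l, k + 1 => fun x => legR T.G.kind (chain T' l).G.kind (legEmb T' l k x)

/-- kernel: one-letter chain, index `0`. [cite: Balaban1983Higgs3, (1.21) p.416] -/
@[simp] theorem legEmb_nil_zero (T : TwoLegGraph nbar) (x : Leg T.G.kind) : legEmb T [] 0 x = x := rfl

/-- kernel: one-letter chain, any index. [cite: Balaban1983Higgs3, (1.21) p.416] -/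
@[simp] theorem legEmb_nil_succ (T : TwoLegGraph nbar) (k : ℕ) (x : Leg T.G.kind) : legEmb T [] (k + 1) x = x := rfl

/-- kernel: block `0` legs are left legs of the first glue. [cite: Balaban1983Higgs3, (1.21) p.416] -/
@[simp] theorem legEmb_cons_zero (T T' : TwoLegGraph nbar) (l : List (TwoLegGraph nbar)) (x : Leg T.G.kind) :
    legEmb T (T' :: l) 0 x = legL T.G.kind (chain T' l).G.kind x := rfl

/-- kernel: block `k + 1` legs are right legs of the first glue. [cite: Balaban1983Higgs3, (1.21) p.416] -/
@[simp] theorem legEmb_cons_succ (T T' : TwoLegGraph nbar) (l : List (TwoLegGraph nbar)) (k : ℕ)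
    (x : Leg (letter T' l k).G.kind) :
    legEmb T (T' :: l) (k + 1) x = legR T.G.kind (chain T' l).G.kind (legEmb T' l k x) := rfl

/-- kernel: the vertex of an embedded leg is the embedded vertex. [cite: Balaban1983Higgs3, (1.21) p.416] -/
theorem fst_legEmb (T : TwoLegGraph nbar) (l : List (TwoLegGraph nbar)) (k : ℕ) (x : Leg (letter T l k).G.kind) :
    (legEmb T l k x).1 = blockEmb T l k x.1 := by
  induction l generalizing T k with
  | nil => cases k <;> rfl
  | cons T' l ih =>
      cases k with
      | zero => rfl
      | succ k => exact (fst_legR _ _ (legEmb T' l k x)).trans (congrArg (Fin.natAdd T.G.nV) (ih T' k x))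

/-- kernel: the species (φ′ / A′) of an embedded leg is kept. [cite: Balaban1983Higgs3, (1.21) p.416] -/
theorem isLeft_legEmb (T : TwoLegGraph nbar) (l : List (TwoLegGraph nbar)) (k : ℕ) (x : Leg (letter T l k).G.kind) :
    (legEmb T l k x).2.isLeft = x.2.isLeft := by
  induction l generalizing T k with
  | nil => cases k <;> rfl
  | cons T' l ih =>
      cases k with
      | zero => exact isLeft_legL _ _ x
      | succ k => exact (isLeft_legR _ _ (legEmb T' l k x)).trans (ih T' k x)

/-- kernel: each leg embedding is injective. [cite: Balaban1983Higgs3, (1.21) p.416] -/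
theorem legEmb_injective (T : TwoLegGraph nbar) (l : List (TwoLegGraph nbar)) (k : ℕ) :
    Function.Injective (legEmb T l k) := by
  induction l generalizing T k with
  | nil => cases k <;> exact fun _ _ h => h
  | cons T' l ih =>
      cases k with
      | zero => exact legL_injective _ _
      | succ k => exact (legR_injective _ _).comp (ih T' k)

/-- kernel: every leg of the chain is an embedded leg of some letter. [cite: Balaban1983Higgs3, (1.21) p.416] -/
theorem exists_legEmb_eq (T : TwoLegGraph nbar) (l : List (TwoLegGraph nbar)) (z : Leg (chain T l).G.kind) :
    ∃ k, k ≤ l.length ∧ ∃ x : Leg (letter T l k).G.kind, legEmb T l k x = z := by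
  induction l generalizing T with
  | nil => exact ⟨0, le_rfl, z, rfl⟩
  | cons T' l ih =>
      rcases exists_legL_or_legR T.G.kind (chain T' l).G.kind z with ⟨x, rfl⟩ | ⟨y, rfl⟩
      · exact ⟨0, Nat.zero_le _, x, rfl⟩
      · obtain ⟨k, hk, x, hx⟩ := ih T' y
        exact ⟨k + 1, by simpa using hk, x, by simp [hx]⟩

/-- **the in-leg of the chain is the in-leg of the head letter**. [cite: Balaban1983Higgs3, (1.21) p.416] -/
theorem legEmb_zero_legIn (T : TwoLegGraph nbar) (l : List (TwoLegGraph nbar)) :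
    legEmb T l 0 T.legIn = (chain T l).legIn := by
  cases l <;> rfl

/-- **the out-leg of the chain is the out-leg of the last letter**. [cite: Balaban1983Higgs3, (1.21) p.416] -/
theorem legEmb_length_legOut (T : TwoLegGraph nbar) (l : List (TwoLegGraph nbar)) :
    legEmb T l l.length (letter T l l.length).legOut = (chain T l).legOut := by
  induction l generalizing T with
  | nil => rfl
  | cons T' l ih =>
      show legR _ _ (legEmb T' l l.length (letter T' l l.length).legOut) = legR _ _ (chain T' l).legOut
      rw [ih]

/-- kernel: a leg other than the in-leg of its letter is not the in-leg of the chain. [cite: Balaban1983Higgs3, (1.21) p.416] -/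
theorem legEmb_ne_legIn (T : TwoLegGraph nbar) (l : List (TwoLegGraph nbar)) (k : ℕ) {x : Leg (letter T l k).G.kind}
    (hx : x ≠ (letter T l k).legIn) : legEmb T l k x ≠ (chain T l).legIn := by
  induction l generalizing T k with
  | nil => cases k <;> exact hx
  | cons T' l ih =>
      cases k with
      | zero => exact fun h => hx (legL_injective _ _ h)
      | succ k => exact fun h => legL_ne_legR _ _ T.legIn _ h.symm

/-- kernel: a leg other than the out-leg of its letter is not the out-leg of the chain. [cite: Balaban1983Higgs3, (1.21) p.416] -/
theorem legEmb_ne_legOut (T : TwoLegGraph nbar) (l : List (TwoLegGraph nbar)) (k : ℕ) {x : Leg (letter T l k).G.kind}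
    (hx : x ≠ (letter T l k).legOut) : legEmb T l k x ≠ (chain T l).legOut := by
  induction l generalizing T k with
  | nil => cases k <;> exact hx
  | cons T' l ih =>
      cases k with
      | zero => exact legL_ne_legR _ _ x _
      | succ k => exact fun h => ih T' k hx (legR_injective _ _ h)

/-- **THE LINES OF A LETTER ARE LINES OF THE CHAIN**: away from the two glued ports (the in-leg of a letter after the head, the
out-leg of a letter before the last), the line through an embedded leg is the embedded line of the letter — and an external
leg stays external: `other (legEmb k x) = (other_k x).map (legEmb k)`. [cite: Balaban1983Higgs3, (1.21) p.416] -/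
theorem other_legEmb (T : TwoLegGraph nbar) (l : List (TwoLegGraph nbar)) (k : ℕ) (x : Leg (letter T l k).G.kind)
    (h₁ : x = (letter T l k).legIn → k = 0) (h₂ : x = (letter T l k).legOut → l.length ≤ k) :
    (chain T l).G.other (legEmb T l k x) = ((letter T l k).G.other x).map (legEmb T l k) := by
  induction l generalizing T k with
  | nil =>
      cases k with
      | zero =>
          show T.G.other x = (T.G.other x).map (legEmb T [] 0)
          cases T.G.other x <;> rfl
      | succ k =>
          show T.G.other x = (T.G.other x).map (legEmb T [] (k + 1))
          cases T.G.other x <;> rfl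
  | cons T' l ih =>
      cases k with
      | zero =>
          have hx : x ≠ T.legOut := fun e => by simpa using h₂ e
          exact glueOther_legL_of_ne (o₁ := T.G.other) (o₂ := (chain T' l).G.other) (b := (chain T' l).legIn) hx
      | succ k =>
          have hx : x ≠ (letter T' l k).legIn := fun e => by simpa using h₁ e
          have hy : legEmb T' l k x ≠ (chain T' l).legIn := legEmb_ne_legIn T' l k hx
          show glueOther T.G.other (chain T' l).G.other T.legOut (chain T' l).legIn (legR _ _ (legEmb T' l k x)) = _
          rw [glueOther_legR_of_ne hy, ih T' k x (fun e => absurd e hx) (fun e => by simpa using h₂ e), Option.map_map]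
          rfl

/-- **THE GLUE LINES**: for `k < l.length` the out-leg of the `k`-th letter is joined, in the chain, to the in-leg of the
`(k+1)`-st letter — the `k`-th propagator line `C₀^ε` written between consecutive insertions of (1.21).
[cite: Balaban1983Higgs3, (1.21) p.416] -/
theorem other_legEmb_legOut (T : TwoLegGraph nbar) (l : List (TwoLegGraph nbar)) {k : ℕ} (hk : k < l.length) :
    (chain T l).G.other (legEmb T l k (letter T l k).legOut) = some (legEmb T l (k + 1) (letter T l (k + 1)).legIn) := by
  induction l generalizing T k with
  | nil => simp at hk
  | cons T' l ih =>
      cases k with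
      | zero =>
          show glueOther T.G.other (chain T' l).G.other T.legOut (chain T' l).legIn (legL _ _ T.legOut) =
            some (legR _ _ (legEmb T' l 0 T'.legIn))
          rw [glueOther_legL_self, legEmb_zero_legIn]
      | succ k =>
          have hy : legEmb T' l k (letter T' l k).legOut ≠ (chain T' l).legIn :=
            legEmb_ne_legIn T' l k (letter T' l k).in_ne_out.symm
          show glueOther T.G.other (chain T' l).G.other T.legOut (chain T' l).legIn
              (legR _ _ (legEmb T' l k (letter T' l k).legOut)) = _
          rw [glueOther_legR_of_ne hy, ih T' (by simpa using hk)]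
          rfl

/-- kernel: the same glue line read from its far end — the in-leg of the `(k+1)`-st letter is joined to the out-leg of the
`k`-th. [cite: Balaban1983Higgs3, (1.21) p.416] -/
theorem other_legEmb_succ_legIn (T : TwoLegGraph nbar) (l : List (TwoLegGraph nbar)) {k : ℕ} (hk : k < l.length) :
    (chain T l).G.other (legEmb T l (k + 1) (letter T l (k + 1)).legIn) = some (legEmb T l k (letter T l k).legOut) :=
  (chain T l).G.other_symm _ _ (other_legEmb_legOut T l hk)

/-- kernel: the in-leg of the head letter is external in the chain (it is the chain's in-leg).
[cite: Balaban1983Higgs3, (1.21) p.416] -/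
theorem other_legEmb_zero_legIn (T : TwoLegGraph nbar) (l : List (TwoLegGraph nbar)) :
    (chain T l).G.other (legEmb T l 0 T.legIn) = none := by
  rw [legEmb_zero_legIn]; exact (chain T l).in_ext

/-- kernel: the out-leg of the last letter is external in the chain (it is the chain's out-leg).
[cite: Balaban1983Higgs3, (1.21) p.416] -/
theorem other_legEmb_length_legOut (T : TwoLegGraph nbar) (l : List (TwoLegGraph nbar)) :
    (chain T l).G.other (legEmb T l l.length (letter T l l.length).legOut) = none := by
  rw [legEmb_length_legOut]; exact (chain T l).out_ext

/-- **THE EXTERNAL LEGS OF THE CHAIN**: an embedded leg of the `k`-th letter (`k ≤ l.length`) is external in the chain iff it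
is external in its letter and is not a glued port. [cite: Balaban1983Higgs3, (1.21) p.416] -/
theorem other_legEmb_eq_none_iff (T : TwoLegGraph nbar) (l : List (TwoLegGraph nbar)) {k : ℕ} (hk : k ≤ l.length)
    (x : Leg (letter T l k).G.kind) :
    (chain T l).G.other (legEmb T l k x) = none ↔
      (letter T l k).G.other x = none ∧ (x = (letter T l k).legIn → k = 0) ∧ (x = (letter T l k).legOut → k = l.length) := by
  constructor
  · intro h
    have h₁ : x = (letter T l k).legIn → k = 0 := by
      rintro rfl
      by_contra hk0
      obtain ⟨k', rfl⟩ := Nat.exists_eq_succ_of_ne_zero hk0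
      rw [other_legEmb_succ_legIn T l (by omega)] at h
      cases h
    have h₂ : x = (letter T l k).legOut → k = l.length := by
      rintro rfl
      by_contra hkl
      rw [other_legEmb_legOut T l (lt_of_le_of_ne hk hkl)] at h
      cases h
    refine ⟨?_, h₁, h₂⟩
    rw [other_legEmb T l k x h₁ (fun e => (h₂ e).ge)] at h
    simpa using h
  · rintro ⟨h, h₁, h₂⟩
    rw [other_legEmb T l k x h₁ (fun e => (h₂ e).ge), h]
    rfl

/-! ## §4 The adjacencies of a chain: inside the letters, and one glue line between consecutive letters -/

/-- **an internal line of a letter is an internal line of the chain**. [cite: Balaban1983Higgs3, (1.21) p.416] -/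
theorem adj_blockEmb (T : TwoLegGraph nbar) (l : List (TwoLegGraph nbar)) (k : ℕ) {v w : Fin (letter T l k).G.nV}
    (h : Adj (letter T l k).G v w) : Adj (chain T l).G (blockEmb T l k v) (blockEmb T l k w) := by
  induction l generalizing T k with
  | nil => cases k <;> exact h
  | cons T' l ih =>
      cases k with
      | zero =>
          exact adj_glue_left (ha := T.out_ext) (hb := (chain T' l).in_ext)
            (hab := out_isLeft_eq_in_isLeft T (chain T' l)) h
      | succ k =>
          exact adj_glue_right (ha := T.out_ext) (hb := (chain T' l).in_ext)
            (hab := out_isLeft_eq_in_isLeft T (chain T' l)) (ih T' k h)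

/-- **consecutive letters are adjacent through their glue line**: the vertex of the out-leg of the `k`-th letter and the
vertex of the in-leg of the `(k+1)`-st. [cite: Balaban1983Higgs3, (1.21) p.416] -/
theorem adj_blockEmb_ports (T : TwoLegGraph nbar) (l : List (TwoLegGraph nbar)) {k : ℕ} (hk : k < l.length) :
    Adj (chain T l).G (blockEmb T l k (letter T l k).legOut.1) (blockEmb T l (k + 1) (letter T l (k + 1)).legIn.1) :=
  adj_iff.2 ⟨legEmb T l k (letter T l k).legOut, legEmb T l (k + 1) (letter T l (k + 1)).legIn,
    other_legEmb_legOut T l hk, fst_legEmb _ _ _ _, fst_legEmb _ _ _ _⟩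

/-- **there is no other line**: an adjacency of the chain is an adjacency inside one letter, or a glue line between the
ports of two consecutive letters. [cite: Balaban1983Higgs3, (1.21) p.416] -/
theorem adj_chain_cases (T : TwoLegGraph nbar) (l : List (TwoLegGraph nbar)) {v w : Fin (chain T l).G.nV}
    (h : Adj (chain T l).G v w) :
    (∃ k, k ≤ l.length ∧ ∃ v' w' : Fin (letter T l k).G.nV,
        blockEmb T l k v' = v ∧ blockEmb T l k w' = w ∧ Adj (letter T l k).G v' w') ∨
    (∃ k, k < l.length ∧
        (blockEmb T l k (letter T l k).legOut.1 = v ∧ blockEmb T l (k + 1) (letter T l (k + 1)).legIn.1 = w ∨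
         blockEmb T l k (letter T l k).legOut.1 = w ∧ blockEmb T l (k + 1) (letter T l (k + 1)).legIn.1 = v)) := by
  induction l generalizing T with
  | nil => exact Or.inl ⟨0, le_rfl, v, w, rfl, rfl, h⟩
  | cons T' l ih =>
      have hport : blockEmb T (T' :: l) 1 (letter T (T' :: l) 1).legIn.1 = Fin.natAdd T.G.nV (chain T' l).legIn.1 := by
        show Fin.natAdd T.G.nV (blockEmb T' l 0 T'.legIn.1) = _
        rw [← fst_legEmb T' l 0 T'.legIn, legEmb_zero_legIn]
      rcases adj_glue_cases (ha := T.out_ext) (hb := (chain T' l).in_ext) (hab := out_isLeft_eq_in_isLeft T (chain T' l)) h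
        with ⟨i, i', rfl, rfl, hii'⟩ | ⟨j, j', rfl, rfl, hjj'⟩ | ⟨rfl, rfl⟩ | ⟨rfl, rfl⟩
      · exact Or.inl ⟨0, Nat.zero_le _, i, i', rfl, rfl, hii'⟩
      · rcases ih T' hjj' with ⟨k, hk, v', w', hv, hw, hadj⟩ | ⟨k, hk, hp⟩
        · exact Or.inl ⟨k + 1, by simpa using hk, v', w', by simp [hv], by simp [hw], hadj⟩
        · refine Or.inr ⟨k + 1, by simpa using hk, ?_⟩
          rcases hp with ⟨h1, h2⟩ | ⟨h1, h2⟩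
          · exact Or.inl ⟨by simp [← h1], by simp [← h2]⟩
          · exact Or.inr ⟨by simp [← h1], by simp [← h2]⟩
      · exact Or.inr ⟨0, by simp, Or.inl ⟨rfl, hport⟩⟩
      · exact Or.inr ⟨0, by simp, Or.inr ⟨rfl, hport⟩⟩

/-! ## §5 The separating lines of a chain: the glue lines (and the separating lines of the letters) -/

/-- **THE SEPARATING LINES OF A CHAIN OF CONNECTED LETTERS**, by their near legs: the `l.length` glue lines (near leg = the
embedded out-leg of the earlier letter) and the embedded separating lines of the letters (`B3OnePIChainGlueLevels.mem_nearLegs_glue` iterated).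
[cite: Balaban1983Higgs3, (1.21) p.416] -/
theorem mem_nearLegs_chain_iff {T : TwoLegGraph nbar} {l : List (TwoLegGraph nbar)} (hT : IsConnected T.G)
    (hl : ∀ T' ∈ l, IsConnected T'.G) (c : Leg (chain T l).G.kind) :
    c ∈ nearLegs (chain T l).G (chain T l).legIn.1 (chain T l).legOut.1 ↔
      (∃ k, k < l.length ∧ c = legEmb T l k (letter T l k).legOut) ∨
      (∃ k, k ≤ l.length ∧ ∃ x ∈ nearLegs (letter T l k).G (letter T l k).legIn.1 (letter T l k).legOut.1,
          c = legEmb T l k x) := by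
  induction l generalizing T with
  | nil =>
      constructor
      · intro hc
        exact Or.inr ⟨0, le_rfl, c, hc, rfl⟩
      · rintro (⟨k, hk, -⟩ | ⟨k, hk, x, hx, rfl⟩)
        · simp at hk
        · obtain rfl : k = 0 := by simpa using hk
          exact hx
  | cons T' l ih =>
      have hT' : IsConnected T'.G := hl T' (by simp)
      have hl' : ∀ T'' ∈ l, IsConnected T''.G := fun T'' h => hl T'' (by simp [h])
      have hC : IsConnected (chain T' l).G := isConnected_chain hT' hl'
      have key := mem_nearLegs_glue (ha := T.out_ext) (hb := (chain T' l).in_ext)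
        (hab := out_isLeft_eq_in_isLeft T (chain T' l)) T.legIn.1 (chain T' l).legOut.1 hT hC (c := c)
      constructor
      · intro hc
        rcases key.1 hc with rfl | ⟨x, hx, rfl⟩ | ⟨y, hy, rfl⟩
        · exact Or.inl ⟨0, by simp, rfl⟩
        · exact Or.inr ⟨0, by simp, x, hx, rfl⟩
        · rcases (ih hT' hl' y).1 hy with ⟨k, hk, rfl⟩ | ⟨k, hk, x, hx, rfl⟩
          · exact Or.inl ⟨k + 1, by simpa using hk, rfl⟩
          · exact Or.inr ⟨k + 1, by simpa using hk, x, hx, rfl⟩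
      · rintro (⟨k, hk, rfl⟩ | ⟨k, hk, x, hx, rfl⟩)
        · cases k with
          | zero => exact key.2 (Or.inl rfl)
          | succ k =>
              exact key.2 (Or.inr (Or.inr ⟨_, (ih hT' hl' _).2 (Or.inl ⟨k, by simpa using hk, rfl⟩), rfl⟩))
        · cases k with
          | zero => exact key.2 (Or.inr (Or.inl ⟨x, hx, rfl⟩))
          | succ k =>
              exact key.2 (Or.inr (Or.inr ⟨_, (ih hT' hl' _).2 (Or.inr ⟨k, by simpa using hk, x, hx, rfl⟩), rfl⟩))

/-- **EVERY GLUE LINE SEPARATES** the in-leg of the chain from its out-leg, with near leg the out-port of the earlier letter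
(connected letters, `k < l.length`). [cite: Balaban1983Higgs3, (1.21) p.416] -/
theorem isNear_chain_legEmb_legOut {T : TwoLegGraph nbar} {l : List (TwoLegGraph nbar)} (hT : IsConnected T.G)
    (hl : ∀ T' ∈ l, IsConnected T'.G) {k : ℕ} (hk : k < l.length) :
    IsNear (chain T l).G (chain T l).legIn.1 (chain T l).legOut.1 (legEmb T l k (letter T l k).legOut) :=
  mem_nearLegs.1 ((mem_nearLegs_chain_iff hT hl _).2 (Or.inl ⟨k, hk, rfl⟩))

/-- kernel: a proper insertion has no line separating its in-leg from its out-leg (`numSep = 0`,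
`B3OnePIChainPieces.isProper_iff_numSep_eq_zero`). [cite: Balaban1983Higgs3, (1.21) p.416] -/
theorem nearLegs_eq_empty_of_proper {X : TwoLegGraph nbar} (hP : IsProper X.G) :
    nearLegs X.G X.legIn.1 X.legOut.1 = ∅ := by
  have h := (isProper_iff_numSep_eq_zero hP.isConnected).1 hP _ _ X.in_ext X.out_ext
  rwa [numSep, card_eq_zero] at h

/-- **FOR PROPER LETTERS THE SEPARATING LINES OF THE CHAIN ARE EXACTLY THE GLUE LINES** — «decompose ∘ glue = identity» at
the level of lines: the chain decomposition of `chain T l` cuts precisely the `l.length` propagator lines the chain was glued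
along. [cite: Balaban1983Higgs3, (1.21) p.416] -/
theorem mem_nearLegs_chain_iff_of_proper {T : TwoLegGraph nbar} {l : List (TwoLegGraph nbar)} (hT : IsProper T.G)
    (hl : ∀ T' ∈ l, IsProper T'.G) (c : Leg (chain T l).G.kind) :
    c ∈ nearLegs (chain T l).G (chain T l).legIn.1 (chain T l).legOut.1 ↔
      ∃ k, k < l.length ∧ c = legEmb T l k (letter T l k).legOut := by
  rw [mem_nearLegs_chain_iff hT.isConnected (fun T' h => (hl T' h).isConnected) c]
  constructor
  · rintro (h | ⟨k, -, x, hx, rfl⟩)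
    · exact h
    · rw [nearLegs_eq_empty_of_proper (letter_pred (P := fun X => IsProper X.G) hT hl k)] at hx
      simp at hx
  · exact Or.inl

/-! ## §6 The level function along a chain: the `k`-th piece of the chain decomposition is the `k`-th block -/

/-- **THE LEVEL FORMULA ALONG A CHAIN OF CONNECTED LETTERS**: a vertex `v` of the `k`-th letter (`k ≤ l.length`) lies, in
the chain, beyond the separating lines of the earlier letters, beyond the `k` earlier glue lines, and beyond the separating
lines of its own letter it lay beyond: `level (blockEmb k v) = Σ_{j<k} numSep (letter j) + k + level_{letter k} v`
(`B3OnePIChainGlueLevels.level_glue_left` / `level_glue_right` iterated). [cite: Balaban1983Higgs3, (1.21) p.416] -/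
theorem level_chain_blockEmb {T : TwoLegGraph nbar} {l : List (TwoLegGraph nbar)} (hT : IsConnected T.G)
    (hl : ∀ T' ∈ l, IsConnected T'.G) {k : ℕ} (hk : k ≤ l.length) (v : Fin (letter T l k).G.nV) :
    level (chain T l).G (chain T l).legIn.1 (chain T l).legOut.1 (blockEmb T l k v) =
      (∑ j ∈ range k, numSep (letter T l j).G (letter T l j).legIn.1 (letter T l j).legOut.1) + k +
        level (letter T l k).G (letter T l k).legIn.1 (letter T l k).legOut.1 v := by
  induction l generalizing T k with
  | nil =>
      obtain rfl : k = 0 := by simpa using hk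
      simp
  | cons T' l ih =>
      have hT' : IsConnected T'.G := hl T' (by simp)
      have hl' : ∀ T'' ∈ l, IsConnected T''.G := fun T'' h => hl T'' (by simp [h])
      have hC : IsConnected (chain T' l).G := isConnected_chain hT' hl'
      cases k with
      | zero =>
          rw [sum_range_zero, zero_add, zero_add]
          exact level_glue_left (ha := T.out_ext) (hb := (chain T' l).in_ext)
            (hab := out_isLeft_eq_in_isLeft T (chain T' l)) T.legIn.1 (chain T' l).legOut.1 hT hC v
      | succ k =>
          have e : level (chain T (T' :: l)).G (chain T (T' :: l)).legIn.1 (chain T (T' :: l)).legOut.1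
              (blockEmb T (T' :: l) (k + 1) v) = numSep T.G T.legIn.1 T.legOut.1 + 1 +
                level (chain T' l).G (chain T' l).legIn.1 (chain T' l).legOut.1 (blockEmb T' l k v) :=
            level_glue_right (ha := T.out_ext) (hb := (chain T' l).in_ext)
              (hab := out_isLeft_eq_in_isLeft T (chain T' l)) T.legIn.1 (chain T' l).legOut.1 hT hC (blockEmb T' l k v)
          rw [e, ih hT' hl' (by simpa using hk) v, sum_range_succ']
          simp only [letter_cons_succ, letter_zero]
          omega

/-- **FOR PROPER LETTERS THE LEVEL IS THE BLOCK INDEX**: if every letter is proper (p37's `IsProper`: connected, no line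
separating two external legs — every 1PI graph is), the vertices of the `k`-th letter have level EXACTLY `k` in the chain:
the `k`-th piece `V_k` of the chain decomposition of `B3OnePIChainDecomposition` contains the `k`-th block.
[cite: Balaban1983Higgs3, (1.21) p.416] -/
theorem level_chain_blockEmb_of_proper {T : TwoLegGraph nbar} {l : List (TwoLegGraph nbar)} (hT : IsProper T.G)
    (hl : ∀ T' ∈ l, IsProper T'.G) {k : ℕ} (hk : k ≤ l.length) (v : Fin (letter T l k).G.nV) :
    level (chain T l).G (chain T l).legIn.1 (chain T l).legOut.1 (blockEmb T l k v) = k := by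
  have h0 : ∀ j, numSep (letter T l j).G (letter T l j).legIn.1 (letter T l j).legOut.1 = 0 := fun j => by
    have hP : IsProper (letter T l j).G := letter_pred (P := fun X => IsProper X.G) hT hl j
    exact (isProper_iff_numSep_eq_zero hP.isConnected).1 hP _ _ (letter T l j).in_ext (letter T l j).out_ext
  rw [level_chain_blockEmb hT.isConnected (fun T' h => (hl T' h).isConnected) hk v,
    sum_eq_zero (fun j _ => h0 j), zero_add]
  have := level_le (G := (letter T l k).G) (i := (letter T l k).legIn.1) (j := (letter T l k).legOut.1) v
  rw [h0 k] at this
  omega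

/-- **«DECOMPOSE ∘ GLUE = IDENTITY» AT VERTEX LEVEL**: for proper letters the level function of the chain IS the block
index — the chain decomposition of the glued graph returns the blocks it was glued from. [cite: Balaban1983Higgs3, (1.21) p.416] -/
theorem level_chain_eq_blockOf {T : TwoLegGraph nbar} {l : List (TwoLegGraph nbar)} (hT : IsProper T.G)
    (hl : ∀ T' ∈ l, IsProper T'.G) (w : Fin (chain T l).G.nV) :
    level (chain T l).G (chain T l).legIn.1 (chain T l).legOut.1 w = blockOf T l w := by
  obtain ⟨k, hk, v, rfl⟩ := exists_blockEmb_eq T l w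
  rw [level_chain_blockEmb_of_proper hT hl hk, blockOf_blockEmb_of_le T l hk]

/-- **THE `k`-TH PIECE IS THE `k`-TH BLOCK**: for proper letters and `k ≤ l.length`, the piece `V_k = {level = k}` of the
chain decomposition is exactly the image of the `k`-th block embedding. [cite: Balaban1983Higgs3, (1.21) p.416] -/
theorem piece_eq_map_blockEmb {T : TwoLegGraph nbar} {l : List (TwoLegGraph nbar)} (hT : IsProper T.G)
    (hl : ∀ T' ∈ l, IsProper T'.G) {k : ℕ} (hk : k ≤ l.length) :
    (univ.filter fun w => level (chain T l).G (chain T l).legIn.1 (chain T l).legOut.1 w = k) =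
      univ.map ⟨blockEmb T l k, blockEmb_injective T l k⟩ := by
  ext w
  simp only [mem_filter, mem_univ, true_and, mem_map, Function.Embedding.coeFn_mk]
  constructor
  · intro hw
    obtain ⟨k', hk', v, rfl⟩ := exists_blockEmb_eq T l w
    rw [level_chain_blockEmb_of_proper hT hl hk'] at hw
    subst hw
    exact ⟨v, rfl⟩
  · rintro ⟨v, rfl⟩
    exact level_chain_blockEmb_of_proper hT hl hk v

/-- **… and has as many vertices as the `k`-th letter**: `#V_k = (letter k).G.nV`. [cite: Balaban1983Higgs3, (1.21) p.416] -/
theorem card_piece {T : TwoLegGraph nbar} {l : List (TwoLegGraph nbar)} (hT : IsProper T.G)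
    (hl : ∀ T' ∈ l, IsProper T'.G) {k : ℕ} (hk : k ≤ l.length) :
    (univ.filter fun w => level (chain T l).G (chain T l).legIn.1 (chain T l).legOut.1 w = k).card =
      (letter T l k).G.nV := by
  rw [piece_eq_map_blockEmb hT hl hk, card_map, card_univ, Fintype.card_fin]

/-- kernel: the in-leg vertex of the chain lies in block `0`, the out-leg vertex in block `l.length`.
[cite: Balaban1983Higgs3, (1.21) p.416] -/
theorem blockOf_ports (T : TwoLegGraph nbar) (l : List (TwoLegGraph nbar)) :
    blockOf T l (chain T l).legIn.1 = 0 ∧ blockOf T l (chain T l).legOut.1 = l.length := by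
  constructor
  · rw [← legEmb_zero_legIn, fst_legEmb]
    simpa using blockOf_blockEmb T l 0 T.legIn.1
  · rw [← legEmb_length_legOut, fst_legEmb, blockOf_blockEmb, min_self]

/-! ## §7 The displayed `n = 2` term ①—C₀^ε—① of (1.21) -/

/-- **the term ①—C₀^ε—① of (1.21)** (p37's `chain (pic1 n̄) [pic1 n̄]`; ① = the φ-tadpole (1.22)① = p18's `g36c`, one
vertex): its two vertices are the two blocks, at levels `0` and `1` — the piece `V_0` is the first tadpole, `V_1` the second.
[cite: Balaban1983Higgs3, (1.22) p.416] -/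
theorem level_chain_pic1_pic1 (v w : Fin (pic1 nbar).G.nV) :
    level (chain (pic1 nbar) [pic1 nbar]).G (chain (pic1 nbar) [pic1 nbar]).legIn.1
        (chain (pic1 nbar) [pic1 nbar]).legOut.1 (blockEmb (pic1 nbar) [pic1 nbar] 0 v) = 0 ∧
    level (chain (pic1 nbar) [pic1 nbar]).G (chain (pic1 nbar) [pic1 nbar]).legIn.1
        (chain (pic1 nbar) [pic1 nbar]).legOut.1 (blockEmb (pic1 nbar) [pic1 nbar] 1 w) = 1 := by
  have hP : IsProper (pic1 nbar).G := (isOnePI_of_nV_eq_one rfl).isProper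
  have hl : ∀ T' ∈ [pic1 nbar], IsProper T'.G := fun T' h => by simp at h; rw [h]; exact hP
  exact ⟨level_chain_blockEmb_of_proper (k := 0) hP hl (by simp) v,
    level_chain_blockEmb_of_proper (k := 1) hP hl (by simp) w⟩

end Literature.MathematicalPhysics.QuantumFieldTheory.Balaban1983to89.B3OnePIChainBlocks
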